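import Mathlib.CategoryTheory.Limits.Preserves.Shapes.BinaryProducts
import Mathlib.CategoryTheory.Limits.Preserves.Shapes.Products
import Mathlib.CategoryTheory.Limits.Preserves.Shapes.Terminal
import Literature.AnabelianGeometry.SemiGraphs.QuasiTemperoidsPiCofanProofs
import Literature.AnabelianGeometry.SemiGraphs.QuasiTemperoidsPropA2Proofs2
import Literature.AnabelianGeometry.SemiGraphs.QuasiTemperoidsProjectionProofs
import Literature.AnabelianGeometry.SemiGraphs.QuasiTemperoidsPiProofs

/-!
# Semi-graphs of anabelioids, Appendix: Proposition A.2 (v), first half — the map `ψ : E → E′` of a morphism of quasi-temperoids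

Mochizuki, *Semi-graphs of anabelioids*, Publ. RIMS **42** (2006), Appendix, Proposition A.2 (v) p. 80
and its proof p. 81: for a morphism `φ : Q = ∏_e Q_e → Q′ = ∏_{e′} Q′_{e′}` of quasi-temperoids,
"consider the various composite functors `κ[e′, e] := π_{e*} ∘ φ^* ∘ ι_{e′} : Q′_{e′} → Q_e` … there is at
most one `e′ ∈ E′` such that the essential image of `κ[e′, e]` contains nonempty objects … [and] at
least one … This yields ψ." PROOF-ONLY file (theorems, no definitions) by abc-iut-w4-d076 over
abc-iut-L3-t2's `QuasiTemperoids.lean`, for ANY family of inclusion functors `ι_{e′}`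
(`IsInclusionFunctor`, Prop. A.2 (ii); they exist by `PropA2ii_holds`, abc-iut-w4-d048):

* `exists_cofan_decomposition`: every object `A′` of `∏ Q′` is the coproduct of the `ι_{e′}(A′_{e′})` along
  canonical arrows `j_{e′} : ι_{e′}(A′_{e′}) → A′` (isomorphism at the coordinate `e′`, from initial objects
  elsewhere), naturally in `A′`;
* `exists_psi`: the print's `ψ` with its two properties — for `e′ ≠ ψ(e)` every `κ[e′, e]`-image is empty
  [initial] (uniqueness: "the product of objects belonging to distinct `Q′`'s will always be an empty
  object of `Q′`" + `φ^*` left exact + "any product of nonempty objects of a connected quasi-temperoid will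
  always be nonempty"), and `κ[ψ(e), e]` carries nonempty objects to nonempty objects (existence:
  "`π_{e*} ∘ φ^*` preserves nondegenerate objects", Prop. A.2 (iii) `PropA2iii_holds`, and the coproduct
  decomposition, `φ^*` and `π_{e*}` preserving countable coproducts — abc-iut-w4-d089's
  `TemperoidProduct.preservesColimitsOfShape_eval`).

[cite: MochizukiSemiAnbd2006, Prop A.2(v) pp.80-81]; typed ≠ endorsed.
-/

open CategoryTheory CategoryTheory.Limits

namespace Literature.AnabelianGeometry.SemiGraphs

open Literature.AlgebraicGeometry.Frobenioids (IsConnectedObj IsNonemptyObj)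
open Literature.AlgebraicGeometry.Frobenioids.QuasiTemperoid (IsConnectedQuasiTemperoid)

universe v₁ v₂ u u₁ u₂

section Decomposition

variable {E' : Type} {Q' : E' → Type u₂} [∀ e', Category.{v₂} (Q' e')]

/-- **Coproduct decomposition of `∏ Q′` along inclusion functors** (the "evident sense" of "taking the
product", Prop. A.2 (v)): for inclusion functors `ι_{e′}` there are arrows `j_{e′}(A′) : ι_{e′}(A′_{e′}) → A′`
(the inverse structural isomorphism at the coordinate `e′`, the arrows from initial objects at the other
coordinates), natural in `A′`, isomorphisms at the coordinate `e′`, exhibiting every `A′` as the coproduct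
`∐_{e′} ι_{e′}(A′_{e′})`. [cite: MochizukiSemiAnbd2006, Prop A.2(v) pp.80-81] -/
theorem exists_cofan_decomposition (ι : ∀ e', Q' e' ⥤ ∀ f, Q' f)
    (hι : ∀ e', IsInclusionFunctor Q' e' (ι e')) :
    ∃ j : ∀ (A' : ∀ f, Q' f) (e' : E'), (ι e').obj (A' e') ⟶ A',
      (∀ A' e', IsIso ((j A' e') e')) ∧
      (∀ (A' B' : ∀ f, Q' f) (g : A' ⟶ B') (e' : E'),
        (ι e').map (g e') ≫ j B' e' = j A' e' ≫ g) ∧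
      ∀ A', Nonempty (IsColimit (Cofan.mk A' (j A'))) := by
  classical
  let σ : ∀ e', (ι e' ⋙ Pi.eval Q' e' ≅ 𝟭 (Q' e')) := fun e' => (hι e').self.some
  let j : ∀ (A' : ∀ f, Q' f) (e' : E'), (ι e').obj (A' e') ⟶ A' := fun A' e' f =>
    if h : f = e' then (by subst h; exact (σ f).hom.app (A' f))
    else ((hι e').other f h (A' e')).some.to (A' f)
  have hj : ∀ A' e', j A' e' e' = (σ e').hom.app (A' e') := fun A' e' => by
    change dite (e' = e') _ _ = _
    rw [dif_pos rfl]
  have hj' : ∀ (A' : ∀ f, Q' f) (e' f : E'), f ≠ e' → Nonempty (IsInitial ((ι e').obj (A' e') f)) :=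
    fun A' e' f h => (hι e').other f h (A' e')
  have hiso : ∀ (A' : ∀ f, Q' f) (e' : E'), IsIso (j A' e' e') := fun A' e' => by
    rw [hj]
    exact Iso.isIso_hom ((σ e').app (A' e'))
  refine ⟨j, hiso, fun A' B' g e' => ?_, fun A' => ?_⟩
  · funext f
    by_cases h : f = e'
    · subst h
      change ((ι f).map (g f)) f ≫ j B' f f = j A' f f ≫ g f
      rw [hj, hj]
      exact (σ f).hom.naturality (g f)
    · exact (hj' A' e' f h).some.hom_ext _ _
  · refine Pi.nonempty_isColimit_of_eval _ fun f =>
      ⟨(isColimitMapCoconeCofanMkEquiv (Pi.eval Q' f) (fun e' => (ι e').obj (A' e')) (j A')).symm ?_⟩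
    exact (nonempty_isColimit_cofan_of_isIso
      (Cofan.mk ((Pi.eval Q' f).obj A') fun e' => (Pi.eval Q' f).map (j A' e')) f (hiso A' f)
      fun e' he' => hj' A' e' f (Ne.symm he')).some

end Decomposition

/-! ### The map `ψ : E → E′` -/

section Psi

variable {E : Type} {Q : E → Type u₁} [∀ e, Category.{v₁} (Q e)]
variable {E' : Type} {Q' : E' → Type u₂} [∀ e', Category.{v₂} (Q' e')]

/-- In a connected quasi-temperoid "any product of nonempty objects … will always be nonempty"
(Prop. A.2 (v), proof p. 81): a binary product cone of two nonempty [non-initial] objects has nonempty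
apex (both are dominated by one connected object, which then maps to the apex).
[cite: MochizukiSemiAnbd2006, Prop A.2(v) pp.80-81] -/
theorem _root_.Literature.AlgebraicGeometry.Frobenioids.QuasiTemperoid.IsConnectedQuasiTemperoid.isNonemptyObj_binaryFan_pt
    {C : Type u₁} [Category.{v₁} C] (hC : IsConnectedQuasiTemperoid.{v₁, u₁, u} C) {X Y : C}
    {c : BinaryFan X Y} (hc : IsLimit c) (hX : IsNonemptyObj X) (hY : IsNonemptyObj Y) :
    IsNonemptyObj c.pt := by
  obtain ⟨D, hD, ⟨kX⟩, ⟨kY⟩⟩ := hC.exists_isConnectedObj_hom_hom hX hY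
  exact hC.isNonemptyObj_of_hom (hc.lift (BinaryFan.mk kX kY)) hD.1

/-- **The map `ψ : E → E′` of a morphism of quasi-temperoids** (Prop. A.2 (v) and its proof, p. 81):
for a morphism `φ : ∏_e Q_e → ∏_{e′} Q′_{e′}` (connected quasi-temperoid factors, `E′` countable) and
inclusion functors `ι_{e′}`, there is `ψ : E → E′` such that (a) for `e′ ≠ ψ(e)` the composite
`κ[e′, e] = π_e ∘ φ^* ∘ ι_{e′}` takes only empty [initial] values — "there is at most one `e′ ∈ E′` such
that the essential image of `κ[e′, e]` contains nonempty objects" (products of objects of distinct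
`Q′`'s are empty; `φ^*` preserves finite products; products of nonempty objects of `Q_e` are nonempty) —
and (b) `κ[ψ(e), e]` carries nonempty objects to nonempty objects — "since `π_{e*} ∘ φ^*` preserves
nondegenerate objects … there exists at least one `e′`" (via the coproduct decomposition along the
`ι_{e′}`, preserved by `φ^*` and `π_e`). [cite: MochizukiSemiAnbd2006, Prop A.2(v) pp.80-81] -/
theorem exists_psi [Countable E] [Countable E'] (hQ : ∀ e, IsConnectedQuasiTemperoid.{v₁, u₁, u} (Q e))
    (hQ' : ∀ e', IsConnectedQuasiTemperoid.{v₂, u₂, u} (Q' e'))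
    (ι : ∀ e', Q' e' ⥤ ∀ f, Q' f) (hι : ∀ e', IsInclusionFunctor Q' e' (ι e'))
    (φ : TemperoidHom (∀ e, Q e) (∀ f, Q' f)) (hφ : φ.PreservesNondegenerate) :
    ∃ ψ : E → E', ∀ e,
      (∀ e', e' ≠ ψ e → ∀ B : Q' e', ¬ IsNonemptyObj ((φ.pullback.obj ((ι e').obj B)) e)) ∧
      (∀ N : Q' (ψ e), IsNonemptyObj N → IsNonemptyObj ((φ.pullback.obj ((ι (ψ e)).obj N)) e)) := by
  classical
  let F := φ.pullback
  haveI : ∀ e, HasInitial (Q e) := fun e => (hQ e).hasInitial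
  haveI : ∀ f, HasInitial (Q' f) := fun f => (hQ' f).hasInitial
  haveI : ∀ f, HasLimitsOfShape (Discrete WalkingPair) (Q' f) :=
    fun f => (hQ' f).hasLimitsOfShape _ ⟨WalkingPair.left⟩
  haveI := φ.preservesFiniteLimits
  haveI : PreservesColimitsOfShape (Discrete E') F := φ.preservesCountableColimits (Discrete E')
  haveI : PreservesColimitsOfShape (Discrete PEmpty.{1}) F := φ.preservesCountableColimits _
  haveI : ∀ e, PreservesColimitsOfShape (Discrete E') (Pi.eval Q e) :=
    fun e => TemperoidProduct.preservesColimitsOfShape_eval e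
  haveI : ∀ e, PreservesLimitsOfShape (Discrete WalkingPair) (Pi.eval Q e) :=
    fun e => TemperoidProduct.preservesLimitsOfShape_eval e
  obtain ⟨j, hjiso, -, hjcol⟩ := exists_cofan_decomposition ι hι
  -- the image under `π_e ∘ φ^*` of the decomposition cofan of `A′` is a coproduct in `Q_e`
  have hdec : ∀ (A' : ∀ f, Q' f) (e : E),
      Nonempty (IsColimit (Cofan.mk ((F.obj A') e) fun e' => (F.map (j A' e')) e)) := fun A' e =>
    ⟨isColimitCofanMkObjOfIsColimit (Pi.eval Q e) _ _
      (isColimitCofanMkObjOfIsColimit F _ _ (hjcol A').some)⟩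
  -- (a, uniqueness) two inclusions with nonempty images at `e` come from the same `e′`
  have huniq : ∀ (e : E) (e₁ e₂ : E') (B₁ : Q' e₁) (B₂ : Q' e₂),
      IsNonemptyObj ((F.obj ((ι e₁).obj B₁)) e) → IsNonemptyObj ((F.obj ((ι e₂).obj B₂)) e) →
      e₁ = e₂ := by
    intro e e₁ e₂ B₁ B₂ h₁ h₂
    by_contra hne
    let X₁ := (ι e₁).obj B₁
    let X₂ := (ι e₂).obj B₂
    -- the coordinatewise product `X₁ × X₂` in `∏ Q′` …
    let π₁ : (fun f => X₁ f ⨯ X₂ f : ∀ f, Q' f) ⟶ X₁ := fun f => prod.fst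
    let π₂ : (fun f => X₁ f ⨯ X₂ f : ∀ f, Q' f) ⟶ X₂ := fun f => prod.snd
    have hP : Nonempty (IsLimit (BinaryFan.mk π₁ π₂)) :=
      Pi.nonempty_isLimit_of_eval _ fun f =>
        ⟨(isLimitMapConeBinaryFanEquiv (Pi.eval Q' f) π₁ π₂).symm (prodIsProd (X₁ f) (X₂ f))⟩
    -- … is initial: at every coordinate one factor is initial
    have hP0 : IsInitial (fun f => X₁ f ⨯ X₂ f : ∀ f, Q' f) := by
      refine TemperoidProduct.isInitialPi _ fun f => ?_
      by_cases hf : f = e₁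
      · subst hf
        have h2 : Nonempty (IsInitial (X₂ f)) := (hι e₂).other f hne B₂
        exact ((hQ' f).nonempty_isInitial_of_hom h2.some prod.snd).some
      · have h1 : Nonempty (IsInitial (X₁ f)) := (hι e₁).other f hf B₁
        exact ((hQ' f).nonempty_isInitial_of_hom h1.some prod.fst).some
    -- its image under `π_e ∘ φ^*` is initial and is a product of two nonempty objects of `Q_e`
    have hFP0 : IsInitial ((F.obj (fun f => X₁ f ⨯ X₂ f : ∀ f, Q' f)) e) :=
      TemperoidProduct.isInitialApply (hP0.isInitialObj F _) e
    have hlim : IsLimit (BinaryFan.mk ((F.map π₁) e) ((F.map π₂) e)) :=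
      mapIsLimitOfPreservesOfIsLimit (Pi.eval Q e) _ _ (mapIsLimitOfPreservesOfIsLimit F _ _ hP.some)
    exact ((hQ e).isNonemptyObj_binaryFan_pt hlim h₁ h₂).false hFP0
  -- (b, existence) some inclusion has a nonempty image at `e`
  have hN' : ∀ f, ∃ N : Q' f, IsConnectedObj N ∧ IsNondegenerateObj N :=
    fun f => (hQ' f).exists_isConnectedObj_isNondegenerateObj
  choose N' hN'c hN'n using hN'
  -- images of a family with all coordinates nonempty: some summand of the decomposition survives
  have hsurv : ∀ (M' : ∀ f, Q' f), (∀ f, IsNonemptyObj (M' f)) → ∀ e,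
      ∃ e', IsNonemptyObj ((F.obj ((ι e').obj (M' e'))) e) := by
    intro M' hM' e
    have hM'n : IsNondegenerateObj M' := (PropA2iii_holds Q' hQ' M').mpr hM'
    have hFM' : IsNonemptyObj ((F.obj M') e) := (PropA2iii_holds Q hQ (F.obj M')).mp (hφ M' hM'n) e
    exact exists_not_isInitial_of_isColimit_cofan (hdec M' e).some hFM'
  have hex : ∀ e, ∃ e', ∃ B : Q' e', IsNonemptyObj ((F.obj ((ι e').obj B)) e) := fun e => by
    obtain ⟨e', he'⟩ := hsurv N' (fun f => (hN'c f).1) e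
    exact ⟨e', N' e', he'⟩
  choose ψ hψ using hex
  refine ⟨ψ, fun e => ⟨fun e' hne B hB => hne ?_, fun N hN => ?_⟩⟩
  · obtain ⟨B₀, hB₀⟩ := hψ e
    exact huniq e e' (ψ e) B B₀ hB hB₀
  · -- replace the `ψ e`-th coordinate of `N′` by `N`
    let M' : ∀ f, Q' f := Function.update N' (ψ e) N
    have hM' : ∀ f, IsNonemptyObj (M' f) := by
      intro f
      by_cases hf : f = ψ e
      · subst hf
        change IsNonemptyObj (Function.update N' (ψ e) N (ψ e))
        rw [Function.update_self]
        exact hN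
      · change IsNonemptyObj (Function.update N' (ψ e) N f)
        rw [Function.update_of_ne hf]
        exact (hN'c f).1
    obtain ⟨e', he'⟩ := hsurv M' hM' e
    have hee : e' = ψ e := by
      obtain ⟨B₀, hB₀⟩ := hψ e
      exact huniq e e' (ψ e) (M' e') B₀ he' hB₀
    subst hee
    have hM'e : M' (ψ e) = N := Function.update_self (ψ e) N N'
    rw [hM'e] at he'
    exact he'

end Psi

end Literature.AnabelianGeometry.SemiGraphs
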